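import Summits.CriticalPhenomena.Ising3DConformalLimit.Theses.FKParityRobustness
import Summits.CriticalPhenomena.Ising3DConformalLimit.Theorems.FKParityRobustnessFarMergingGivesU4
import Summits.CriticalPhenomena.Ising3DConformalLimit.Theorems.FKParityRobustnessDefs
import Summits.CriticalPhenomena.Ising3DConformalLimit.Theorems.FKParityRobustnessParityRobustMergingFKTransfer
import Summits.CriticalPhenomena.Ising3DConformalLimit.Theorems.FKParityRobustnessParityRobustMergingEvenSubgraphCount
import Summits.CriticalPhenomena.Ising3DConformalLimit.Theorems.FKParityRobustnessParityRobustMergingGrimmettJanson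
import Literature.Probability.LatticeModels.LoopO1
import Literature.Probability.LatticeModels.ModifiedSimonInequality
import HarnessLib

/-!
# Skeleton line `xor-coordinates` for crux `JoinForcesU4` (stmt-CriticalPhenomena-14627)

Route `FKParityRobustness` (rev 8), crux r6 `JoinForcesU4` = the BRIDGE
`IndependentStrandsJoin → ∀ ρ S, (ρ > 0 on (0,1]) → HasPointwiseScalingLimit (criticalCorr 3) ρ S →
IsNondegenerateTwoPoint S → HasNontrivialU4 S` (K1 → item 0636 inlined).

STATUS OF THE CRUX (read first). The crux already has TWO kernel-checked candidate proofs in this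
directory awaiting a prover's landing (`CandidateProof_JoinForcesU4.lean`, `SketchIdeator3.lean`: the
CURRENT-side chain (A) two-copy odd-part pushforward ∘ (B) box transport ∘ (C) far merging; triage r1-1,
r1-2: "no lead cycle warranted, land it"). This line is the INDEPENDENT, CURRENTS-FREE second proof of
step (A) (`StrandsJoinBound`, item 14647) through an EXACT loop-O(1) identity for `U₄`, and it reaches the
crux BY NAME through the shared half: the route's own support `LatticeBoundFromStrands` (item 14648,
hypothesis of `JoinForcesU4_of` by name; its proof `latticeBoundFromStrands_proof` appeared under
`Theorems/FKParityRobustnessLatticeBoundFromStrands.lean` at 06:06Z while this skeleton was being checked, next to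
`Theorems/FKParityRobustnessStrandsJoinBound.lean` = the current-side proof of step (A)) and the LANDED proof of
item 4471 `farMergingGivesU4_proof` (`Theorems/FKParityRobustnessFarMergingGivesU4.lean`) at the tetrahedron. Its stubs are worth
landing even after the crux closes: (★★) is a Literature-grade identity (triage r1-2 sharpening (i)),
and the XOR vocabulary is the one in which K1 (item 14625) is EQUIVALENT to the tetrahedral lattice
`U₄` bound (the converse `StrandsJoinConverse` below, recorded for the rank-2 campaign, not a stub).

## The line (idea card `Ideas/xor-coordinates.md`; triage r1-1: pass, r1-2: pass)

Work with PAIRS of `T`-joins in XOR COORDINATES `(F₁, F₂) ↦ (U, D, A) := (F₁ ∆ F₂, F₁ ∩ F₂, F₁ ∖ F₂)`: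
a bijection `T(S₁) × T(S₂) ≃ {(U, D, A) : ∂U = S₁ ∆ S₂, D ⊆ E ∖ U, A ⊆ U, ∂A = S₁ ∆ ∂D}` with
`|F₁| + |F₂| = 2|D| + |U|` (`stub_xorDecomposition`), whose fibre over `(U, D)` is counted by the
coset law `#{A ⊆ U : ∂A = T} = 1[every U-cluster holds an even number of T-vertices] · #𝓔_∅(U)`
(`stub_cosetCriterion`). With `Q = {a₀,…,a₃}`, `Z^S = Z^S_t = loopO1PartitionFunction G t S`, all four
products `Z^{ab}Z^{cd}` (three pairings) and `Z^Q Z^∅` become sums over ONE pattern space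
`{(U, D) : ∂U = Q, D ⊆ E ∖ U}` with weight `t^{2|D|+|U|} #𝓔_∅(U)` and a parity indicator that depends
only on how the clusters of `U` split `Q` (4 | 2+2 in one of three pairings) and on the `U`-parities of
`∂D`; the four-term Ursell combination telescopes PATTERN BY PATTERN (`U` joins `Q`: `(3−1)·1[D U-even]`;
`U` pairs `Q`: `2·1[D U-odd exactly at the two pair-clusters]`) into the EXACT identity
(`stub_loopUrsellIdentity`, all real `t`, every finite graph; `E(U) :≡ a₀ ↔_U a₂ ∨ a₀ ↔_U a₃`):

(★★) `Z^{01}Z^{23} + Z^{02}Z^{13} + Z^{03}Z^{12} − Z^Q Z^∅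
        = 2·( Σ_{F₁ ∈ T01, F₂ ∈ T23} t^{|F₁|+|F₂|} 1[E(F₁ ∆ F₂)] + Σ_{F₁ ∈ T02, F₂ ∈ T13} t^{|F₁|+|F₂|} 1[¬E(F₁ ∆ F₂)] )
        =: 2·(A + B)`.

By the high-temperature expansion the left side is `−U₄(a)·(Z^∅)²` at `t = tanh β`
(`stub_loopUrsellDictionary`). `StrandsJoinBound` asks `U₄·(Z^∅)² ≤ −2·J∪` with
`J∪ = Σ_{T01×T23} t^{…} 1[a₀ ↔ a₂ in F₁ ∪ F₂]`, i.e. `J∪ ≤ A + B`. Every `A`-pair is a `J∪`-pair; the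
`J∪`-pairs missing from `A` have `U = F₁ ∆ F₂` pairing `a₀a₁ | a₂a₃` (`¬E(U)`) while `D = F₁ ∩ F₂`
bridges the two clusters, and in XOR coordinates (`stub_xorSlack`, exact, all `t`)
`J∪ − A = Σ_{U : ∂U = Q, ¬E(U)} t^{|U|} #𝓔_∅(U) · L_{t²}(U; a₀, a₂)`,
`B = Σ_{U : ∂U = Q, ¬E(U)} t^{|U|} #𝓔_∅(U) · R_{t²}(U; a₀, a₂)`, where for an edge set `U`, vertices
`x ≁_U y` and a weight `s`: `L_s(U;x,y) = Σ {s^{|D|} : D ⊆ E∖U, ∂D U-even, x ↔ y in U ∪ D}` and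
`R_s(U;x,y) = Σ {s^{|D|} : D ⊆ E∖U, ∂D U-odd exactly at the U-clusters of x and y}`. The one
inequality of the line is the per-`U` comparison `L_s ≤ R_s` for `0 ≤ s ≤ 1` (`stub_perUComparison`;
= the loop-O(1) ⊆ FK-Ising two-point comparison `ℓ^∅_{H,s}[x̄ ↔ ȳ] ≤ ⟨σ_x̄ σ_ȳ⟩_{H, tanh β' = s}` on the
multigraph `H = (E∖U)/U-clusters`, triage r1-1/r1-2 sharpening; direct proof: superset resummation
`s^{|D|} = Σ_{ω ⊇ D} s^{|ω|}(1−s)^{|E∖U∖ω|}` (landed `sum_superset_pow_mul_pow`) and, inside each `ω`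
that connects `x̄, ȳ`, the involution `D ↦ D ∆ P₀` (`P₀` = the off-`U` edges of an `x–y` path in
`U ∪ ω`) mapping U-even `D` to `D` U-odd exactly at `C_x, C_y`; no bridge ⇒ `L`'s count is `0`).
Hence `J∪ = A + Σ wL ≤ A + Σ wR = A + B = −U₄ Z⁰²/2` (`t = tanh β ∈ [0,1)`, `w ≥ 0`): `StrandsJoinBound`
(`strandsJoinBound_of_xor`, REAL proof below), then `LatticeBoundFromStrands` (item 14648, by name) and
the landed `farMergingGivesU4_proof` (item 4471) give the crux (`JoinForcesU4_of`, real proof).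

Exact checks (evidence on item 14627): (★★) as an integer-polynomial identity on 8 + 14 + 21 graph ×
labelling instances (ideator `xor-coordinates-checks.md`; triage `xor_triage_check_with_output.md`,
`xor_check_with_output.txt`), the slack identities and `R − L ≥ 0` on `[0,1]` for every `U` (all),
`R − L < 0` at `t = 3/2` on K4 (`4s − 6s² + 4s³ − s⁴`): `s ≤ 1` is load-bearing. C4 by hand (docstrings).

## Disproof used (`Cruxes/JoinForcesU4/Disproof.lean`, cdisprove cycle 1; verdict NOT REFUTED) and the
## LANDED `Theorems/JoinForcesU4/Negative/LoadBearing.lean` (p82571; READ in full)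

NOTE ON THE IMPORT: `import Summits.CriticalPhenomena.Ising3DConformalLimit.Theorems.JoinForcesU4.Negative.LoadBearing`
belongs in the header of this file (so that every stub elaborates next to the landed Negative lemmas of the
crux); it is omitted ONLY because the farm had not yet built that freshly landed module at publish time
(`lean check`: `remote:stale:unbuilt:…LoadBearing`, 2026-08-16T06–07Z). Nothing below uses it (the
composition goes through `farMergingGivesU4_proof`); the lead should add the import back on the first reshape.

* §C.4 `not_loopAizenmanAllT` (the all-`t` polynomial strengthening of `StrandsJoinBound` is FALSE, C4 at
  `t = 2`): honoured — the identities (★★)/slack are all-`t`, the INEQUALITY enters only through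
  `stub_perUComparison` at `s = t² ∈ [0,1]`, and `strandsJoinBound_of_xor` feeds it `tanh β < 1`.
* §A `iff_withoutPositivity` (`hρ` cosmetic): `JoinForcesU4_of` ignores `hρ`.
  `withoutNondegeneracy_iff_not_strandsJoin`, `withoutLimit_iff_not_strandsJoin` (ND and the lattice
  limit are load-bearing): both are consumed inside the landed `farMergingGivesU4_proof` (item 4471:
  strict sign from `S₂ > 0`, limit along `δ = 1/L`), which the composition calls — not bypassed.
* §B `crux_of_supports : StrandsJoinBound → LatticeBoundFromStrands → Crux` is exactly this skeleton's
  frame (`StrandsJoinBound` DERIVED from the stubs, `LatticeBoundFromStrands` by name); landed twins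
  `not_crux_imp_not_support`, `latticeBoundFromStrands_iff`, `hasNontrivialU4_of_tetraBound_io`
  (LoadBearing.lean: none of its 22 theorems refutes an instance of a stub — they concern the anatomy of
  the bridge, K1 / 0636 witnesses (`zeroFamily`, `wickUnitFamily`) and `d ≥ 5`; the stubs below are
  finite-graph statements disjoint from all of them).
* §D / barrier `IsingTrivialityFromDimensionFour`: every stub is a dimension-free finite-graph identity or
  inequality; the `d = 3` content stays in K1 (`not_farMergingAt_of_exists_limit`, landed).
* Targets / near-misses / landed Negative lemmas refuting a stub instance: none (Disproof index: "TARGETS: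
  none", "NEAR-MISSES: none"); `ledger negatives` (9 items: SAW, Cardy, percolation) unrelated.
-/

noncomputable section

open Finset
open scoped symmDiff
open Literature.Probability.LatticeModels
open Summit.CriticalPhenomena.Ising3DConformalLimit.Theses.FKParityRobustness
open Summit.CriticalPhenomena.Ising3DConformalLimit.FKParityRobustnessFarMergingGivesU4 (farMergingGivesU4_proof)

namespace Summit.CriticalPhenomena.Ising3DConformalLimit.Cruxes.JoinForcesU4.XorCoordinates

open scoped Classical

/-! ### Vocabulary (finite graph `G` on `V`; all plain `Finset` sums over `G.edgeFinset.powerset`) -/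

section Vocabulary

variable {V : Type*} [Fintype V] [DecidableEq V]

/-- `x ↔_F y`: `x` and `y` are joined by the edge set `F` (reachability in `fromEdgeSet ↑F`; reflexive). -/
def Conn (F : Finset (Sym2 V)) (x y : V) : Prop :=
  (SimpleGraph.fromEdgeSet (↑F : Set (Sym2 V))).Reachable x y

/-- The XOR event `E(U)` of the line for four marked vertices: `a₀ ↔_U a₂ ∨ a₀ ↔_U a₃`. For `U` with
`∂U = {a₀,a₁,a₂,a₃}` its negation says exactly "`U` pairs `a₀a₁ | a₂a₃`". -/
def XorEvent (a : Fin 4 → V) (U : Finset (Sym2 V)) : Prop :=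
  Conn U (a 0) (a 2) ∨ Conn U (a 0) (a 3)

/-- `U`-parity of an edge set `D` at the `U`-cluster of `v`: the number of odd-`D`-degree vertices
(`oddDegVerts D = ∂D`) in the `U`-component of `v` is odd. (`∂D` is "`U`-even" iff this fails at every `v`.) -/
def UOddAt (U D : Finset (Sym2 V)) (v : V) : Prop :=
  Odd #((oddDegVerts D).filter fun w => Conn U v w)

variable (G : SimpleGraph V) [DecidableRel G.Adj]

/-- `J∪`: the joint sum of the crux hypothesis / of `StrandsJoinBound` — VERBATIM the double sum of the
route decls (pairs of `T`-joins of `{a₀,a₁}` and `{a₂,a₃}` joining `a₀` to `a₂` in their UNION). -/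
def jointSumUnion (t : ℝ) (a : Fin 4 → V) : ℝ :=
  ∑ F₁ ∈ tJoins G Set.univ {a 0, a 1}, ∑ F₂ ∈ tJoins G Set.univ {a 2, a 3},
    if (SimpleGraph.fromEdgeSet ((↑F₁ : Set (Sym2 V)) ∪ ↑F₂)).Reachable (a 0) (a 2)
      then t ^ (#F₁ + #F₂) else 0

/-- `A`: pairs `(F₁, F₂) ∈ T{a₀,a₁} × T{a₂,a₃}` whose XOR satisfies `E` (`a₀ ↔ a₂` or `a₀ ↔ a₃` in `F₁ ∆ F₂`). -/
def xorSumA (t : ℝ) (a : Fin 4 → V) : ℝ :=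
  ∑ F₁ ∈ tJoins G Set.univ {a 0, a 1}, ∑ F₂ ∈ tJoins G Set.univ {a 2, a 3},
    if XorEvent a (F₁ ∆ F₂) then t ^ (#F₁ + #F₂) else 0

/-- `B`: pairs `(F₁, F₂) ∈ T{a₀,a₂} × T{a₁,a₃}` whose XOR fails `E` (i.e. pairs `a₀a₁ | a₂a₃`). -/
def xorSumB (t : ℝ) (a : Fin 4 → V) : ℝ :=
  ∑ F₁ ∈ tJoins G Set.univ {a 0, a 2}, ∑ F₂ ∈ tJoins G Set.univ {a 1, a 3},
    if ¬ XorEvent a (F₁ ∆ F₂) then t ^ (#F₁ + #F₂) else 0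

/-- `L_s(U; x, y) = Σ {s^{|D|} : D ⊆ E(G) ∖ U, ∂D U-even, x ↔ y in U ∪ D}` (the "bridging, U-even" mass). -/
def bridgeSumL (s : ℝ) (U : Finset (Sym2 V)) (x y : V) : ℝ :=
  ∑ D ∈ (G.edgeFinset \ U).powerset with (∀ v, ¬ UOddAt U D v) ∧ Conn (U ∪ D) x y, s ^ #D

/-- `R_s(U; x, y) = Σ {s^{|D|} : D ⊆ E(G) ∖ U, ∂D U-odd exactly at the U-clusters of x and of y}`. -/
def oddSumR (s : ℝ) (U : Finset (Sym2 V)) (x y : V) : ℝ :=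
  ∑ D ∈ (G.edgeFinset \ U).powerset with (∀ v, UOddAt U D v ↔ (Conn U v x ∨ Conn U v y)), s ^ #D

/-- The PAIRING `Q`-joins: `U ∈ T{a₀,a₁,a₂,a₃}` with `¬E(U)` (the clusters of `U` pair `a₀a₁ | a₂a₃`). -/
def pairingJoins (a : Fin 4 → V) : Finset (Finset (Sym2 V)) :=
  (tJoins G Set.univ {a 0, a 1, a 2, a 3}).filter fun U => ¬ XorEvent a U

end Vocabulary

/-! ### The stub STATEMENTS (named `Prop`s, closed; the registered `stub_*` theorems restate them verbatim) -/

/-- Statement of STUB XD — **XOR change of variables on pairs of `T`-joins** (the card's First lemma):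
for every weight `t`, source sets `S₁, S₂` and test function `Φ(D, U)`,
`Σ_{F₁ ∈ T(S₁)} Σ_{F₂ ∈ T(S₂)} t^{|F₁|+|F₂|} Φ(F₁ ∩ F₂, F₁ ∆ F₂)
  = Σ_{U ∈ T(S₁ ∆ S₂)} Σ_{D ⊆ E∖U} t^{2|D|+|U|} · #{A ⊆ U : ∂A = S₁ ∆ ∂D} · Φ(D, U)`
(bijection `(F₁,F₂) ↦ (F₁ ∆ F₂, F₁ ∩ F₂, F₁ ∖ F₂)`, inverse `(U,D,A) ↦ (D ⊔ A, D ⊔ (U ∖ A))`;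
`#{A ⊆ U : ∂A = T} = #(tJoins G ↑U T)`). Dimension-free, all `t`. -/
def XorDecomposition : Prop :=
  ∀ (V : Type) [Fintype V] [DecidableEq V] (G : SimpleGraph V) [DecidableRel G.Adj]
    (t : ℝ) (S₁ S₂ : Finset V) (Φ : Finset (Sym2 V) → Finset (Sym2 V) → ℝ),
    ∑ F₁ ∈ tJoins G Set.univ S₁, ∑ F₂ ∈ tJoins G Set.univ S₂, t ^ (#F₁ + #F₂) * Φ (F₁ ∩ F₂) (F₁ ∆ F₂) =
      ∑ U ∈ tJoins G Set.univ (S₁ ∆ S₂), ∑ D ∈ (G.edgeFinset \ U).powerset,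
        t ^ (2 * #D + #U) * (#(tJoins G (↑U : Set (Sym2 V)) (S₁ ∆ oddDegVerts D)) : ℝ) * Φ D U

/-- Statement of STUB CC — **coset criterion** (the `T`-join count inside an edge set): for `U ⊆ E(G)`
and any `T`, the number of `A ⊆ U` with `∂A = T` is `#𝓔_∅(U)` (the size of the cycle space of `U`,
landed switching count `card_tJoins_eq_card_evenSubgraphs`) if EVERY `U`-cluster contains an even number
of `T`-vertices, and `0` otherwise (handshake per cluster; existence by pairing the `T`-vertices of a
cluster along `U`-paths and XOR-ing, cf. landed `tJoins_nonempty_of_reachable`, `symmDiff_mem_tJoins`). -/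
def CosetCriterion : Prop :=
  ∀ (V : Type) [Fintype V] [DecidableEq V] (G : SimpleGraph V) [DecidableRel G.Adj]
    (U : Finset (Sym2 V)), U ⊆ G.edgeFinset → ∀ T : Finset V,
      #(tJoins G (↑U : Set (Sym2 V)) T) =
        if ∀ v : V, Even #(T.filter fun w => Conn U v w) then #(evenSubgraphs G (↑U : Set (Sym2 V))) else 0

/-- Statement of STUB LU — **the loop Ursell identity (★★)** (C⁺ of the card; exact, all real `t`,
every finite graph, `a` injective):
`Z^{01}Z^{23} + Z^{02}Z^{13} + Z^{03}Z^{12} − Z^{0123} Z^∅ = 2·(A + B)` with `A = xorSumA`, `B = xorSumB`.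
At `t = tanh β` the left side is `−U₄(a)·(Z^∅)²` (STUB HD), so this is Aizenman's
`U₄ = −2⟨σσ⟩⟨σσ⟩·P⊗P[clusters meet]` with the double current replaced by the XOR of two INDEPENDENT
sourced high-temperature graphs and "meet" by "how the `Q`-join `F₁ ∆ F₂` pairs the four points".
C4 by hand (`0–1–2–3–0`, `a = id`): `2(t+t³)² + 4t⁴ − 2t²(1+t⁴) = 8t⁴ = 2(2t⁴ + 2t⁴)`. -/
def LoopUrsellIdentity : Prop :=
  ∀ (V : Type) [Fintype V] [DecidableEq V] (G : SimpleGraph V) [DecidableRel G.Adj]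
    (t : ℝ) (a : Fin 4 → V), Function.Injective a →
      loopO1PartitionFunction G t {a 0, a 1} * loopO1PartitionFunction G t {a 2, a 3} +
          loopO1PartitionFunction G t {a 0, a 2} * loopO1PartitionFunction G t {a 1, a 3} +
          loopO1PartitionFunction G t {a 0, a 3} * loopO1PartitionFunction G t {a 1, a 2} -
        loopO1PartitionFunction G t {a 0, a 1, a 2, a 3} * loopO1PartitionFunction G t ∅ =
      2 * (xorSumA G t a + xorSumB G t a)

/-- Statement of STUB XS — **the two slack identities in XOR coordinates** (exact, all real `t`,
`a` injective): with `w(U) = t^{|U|} · #𝓔_∅(U)` over the pairing `Q`-joins `U` (`∂U = Q`, `¬E(U)`),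
(a) `J∪ − A = Σ_U w(U) · L_{t²}(U; a₀, a₂)` — every `A`-pair joins `a₀, a₂` in `F₁ ∪ F₂` (a `T{a₂,a₃}`-join
joins `a₂` to `a₃`), the remaining `J∪`-pairs have `U = F₁ ∆ F₂` pairing `a₀a₁|a₂a₃`, `D = F₁ ∩ F₂` with
`∂D` `U`-even (coset criterion for `T = {a₀,a₁} ∆ ∂D`) and `a₀ ↔ a₂` in `U ∪ D = F₁ ∪ F₂`;
(b) `B = Σ_U w(U) · R_{t²}(U; a₀, a₂)` — coset criterion for `T = {a₀,a₂} ∆ ∂D` on a pairing `U`: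
non-empty iff `∂D` is `U`-odd exactly at the clusters of `a₀` and `a₂`.
C4 check: `J∪ − A = t⁶ = t²·1·(t²)²`, `B = 2t⁴ = t²·1·2t²`. -/
def XorSlackIdentities : Prop :=
  ∀ (V : Type) [Fintype V] [DecidableEq V] (G : SimpleGraph V) [DecidableRel G.Adj]
    (t : ℝ) (a : Fin 4 → V), Function.Injective a →
      (jointSumUnion G t a - xorSumA G t a =
          ∑ U ∈ pairingJoins G a,
            t ^ #U * (#(evenSubgraphs G (↑U : Set (Sym2 V))) : ℝ) * bridgeSumL G (t ^ 2) U (a 0) (a 2)) ∧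
      (xorSumB G t a =
          ∑ U ∈ pairingJoins G a,
            t ^ #U * (#(evenSubgraphs G (↑U : Set (Sym2 V))) : ℝ) * oddSumR G (t ^ 2) U (a 0) (a 2))

/-- Statement of STUB PU — **per-`U` comparison** (the ONE inequality of the line; `s ≤ 1` load-bearing,
Disproof §C.4): for `0 ≤ s ≤ 1`, `U ⊆ E(G)` and `x ≁_U y`, `L_s(U; x, y) ≤ R_s(U; x, y)`. Equivalently,
on the multigraph `H = (E∖U)/U-clusters`: `ℓ^∅_{H,s}[x̄ ↔ ȳ]·Z^∅_H ≤ Z^{x̄ȳ}_H`, i.e. loop-O(1)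
connection ≤ Ising two-point function at `tanh β' = s` (Grimmett–Janson coupling `ℓ_s ⊆ FK_{2s/(1+s)}`
+ Edwards–Sokal, or the HJK switching principle); direct route: superset resummation
(`sum_superset_pow_mul_pow`, needs `0 ≤ s ≤ 1`) + the involution `D ↦ D ∆ P₀` inside each `ω`. -/
def PerUComparison : Prop :=
  ∀ (V : Type) [Fintype V] [DecidableEq V] (G : SimpleGraph V) [DecidableRel G.Adj]
    (s : ℝ), 0 ≤ s → s ≤ 1 → ∀ (U : Finset (Sym2 V)), U ⊆ G.edgeFinset → ∀ x y : V, ¬ Conn U x y →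
      bridgeSumL G s U x y ≤ oddSumR G s U x y

/-- Statement of STUB HD — **high-temperature dictionary for `U₄`**: on every finite graph, `β ≥ 0`,
`a` injective, `t = tanh β`:
`U₄^free(a) · (Z^∅_t)² = Z^{0123}_t Z^∅_t − (Z^{01}_t Z^{23}_t + Z^{02}_t Z^{13}_t + Z^{03}_t Z^{12}_t)`,
from `connectedFour = ⟨σ_Q⟩ − Σ_pairings ⟨σσ⟩⟨σσ⟩` (`nPoint_isingMeasure`, `twoPoint`),
`⟨σ_A⟩^free_G = g(A)/g(∅)` (`isingCorr_free_eq_hteSum_div`, PROVED) and the two `T`-join spellings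
`hteSum G univ t A = loopO1PartitionFunction G t A` (`edgesIn_univ`, `oddVerts univ` vs `oddDegVerts`). -/
def LoopUrsellDictionary : Prop :=
  ∀ (V : Type) [Fintype V] [DecidableEq V] (G : SimpleGraph V) [DecidableRel G.Adj] (β : ℝ), 0 ≤ β →
    ∀ a : Fin 4 → V, Function.Injective a →
      connectedFour (isingMeasure G Finset.univ β 0 .free) spinAt a *
          (loopO1PartitionFunction G (Real.tanh β) ∅) ^ 2 =
        loopO1PartitionFunction G (Real.tanh β) {a 0, a 1, a 2, a 3} *
            loopO1PartitionFunction G (Real.tanh β) ∅ -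
          (loopO1PartitionFunction G (Real.tanh β) {a 0, a 1} * loopO1PartitionFunction G (Real.tanh β) {a 2, a 3} +
            loopO1PartitionFunction G (Real.tanh β) {a 0, a 2} * loopO1PartitionFunction G (Real.tanh β) {a 1, a 3} +
            loopO1PartitionFunction G (Real.tanh β) {a 0, a 3} * loopO1PartitionFunction G (Real.tanh β) {a 1, a 2})

/-- NOT A STUB (recorded for the rank-2 campaign on `IndependentStrandsJoin`, item 14625; the dividend
P3 of the card, triage r1-2 (ii)): the CONVERSE at symmetric configurations. If a graph automorphism
fixes `a₀, a₃` and swaps `a₁, a₂` (box graph of `ℤ³` with `a = l • tetra`: swap `y ↔ z`), then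
`B ≤ A ≤ J∪`, so (★★) gives `−U₄·(Z^∅)² ≤ 4·J∪`: the tetrahedral lattice bound `U₄ ≤ −c·G·G` and K1 are
equivalent up to constants (`c ↦ c/4`, and any `c' < c/4` after `N → ∞`). Numerically TRUE on the 4
symmetric test graphs, FALSE without the symmetry (P4, Petersen) — triage r1-2. -/
def StrandsJoinConverse : Prop :=
  ∀ (V : Type) [Fintype V] [DecidableEq V] (G : SimpleGraph V) [DecidableRel G.Adj]
    (t : ℝ), 0 ≤ t → ∀ a : Fin 4 → V, Function.Injective a →
      (∃ φ : G ≃g G, φ (a 0) = a 0 ∧ φ (a 3) = a 3 ∧ φ (a 1) = a 2 ∧ φ (a 2) = a 1) →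
        loopO1PartitionFunction G t {a 0, a 1} * loopO1PartitionFunction G t {a 2, a 3} +
            loopO1PartitionFunction G t {a 0, a 2} * loopO1PartitionFunction G t {a 1, a 3} +
            loopO1PartitionFunction G t {a 0, a 3} * loopO1PartitionFunction G t {a 1, a 2} -
          loopO1PartitionFunction G t {a 0, a 1, a 2, a 3} * loopO1PartitionFunction G t ∅ ≤
        4 * jointSumUnion G t a

/-! ### The registered stubs (`sorry` lives ONLY here) -/

/-- STUB XD (S–M; the card's First lemma, reported PROVED by the ideator as `xor_pattern_decomposition`,
evidence `XorDecomp.lean` on item 14627, ~170 lines: `Finset.sum_nbij'` over a sigma type with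
`i (F₁,F₂) = ⟨F₁ ∆ F₂, F₁ ∩ F₂, F₁ ∖ F₂⟩`, `j ⟨U,D,A⟩ = (D ∪ A, D ∪ (U ∖ A))`, parities by
`oddDegVerts (S ∆ T) = oddDegVerts S ∆ oddDegVerts T` from `even_edgeDeg_symmDiff_iff`). -/
theorem stub_xorDecomposition : XorDecomposition := by
  sorry

/-- STUB CC (M) — the coset criterion `#(tJoins G ↑U T) = 1[parity] · #𝓔_∅(U)` for `U ⊆ E(G)`. -/
theorem stub_cosetCriterion : CosetCriterion := by
  sorry

/-- STUB LU (L, HARDEST) — the loop Ursell identity (★★), GIVEN the change of variables XD and the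
coset criterion CC: apply XD to the four products (`(S₁,S₂) = (01,23), (02,13), (03,12), (Q,∅)`, all with
`S₁ ∆ S₂ = Q` for injective `a`), land on the common pattern space `{(U,D) : ∂U = Q, D ⊆ E∖U}`, evaluate
each count by CC (a `Q`-join's clusters hold 4 or 2+2 of the `aᵢ` — handshake per cluster), telescope
`(3−1)·1[∂D U-even]` on joining `U` and `2·1[∂D U-odd exactly at the pair-clusters]` on pairing `U`, and
read the result back through XD as `2(A + B)`. -/
theorem stub_loopUrsellIdentity : XorDecomposition → CosetCriterion → LoopUrsellIdentity := by
  sorry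

/-- STUB XS (M) — the two slack identities, GIVEN XD and CC (one application of XD each, with
`Φ(D,U) = 1[a₀ ↔ a₂ in U ∪ D ∧ ¬E(U)]`, resp. `Φ(D,U) = 1[¬E(U)]`; `F₁ ∪ F₂ = (F₁ ∆ F₂) ∪ (F₁ ∩ F₂)`;
on a pairing `U` the cluster of `a₀` is the cluster of `a₁` and avoids `a₂, a₃`). -/
theorem stub_xorSlack : XorDecomposition → CosetCriterion → XorSlackIdentities := by
  sorry

/-- STUB PU (M) — the per-`U` comparison `L_s ≤ R_s` on `[0,1]` (a KNOWN two-point comparison in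
costume, triage r1-1/r1-2: loop-O(1) connection ≤ FK/Ising connection on the contracted multigraph). -/
theorem stub_perUComparison : PerUComparison := by
  sorry

/-- STUB HD (S–M) — the high-temperature dictionary `U₄·(Z^∅)² = Z^Q Z^∅ − ΣZZ` at `t = tanh β`. -/
theorem stub_loopUrsellDictionary : LoopUrsellDictionary := by
  sorry

/-! ### Consistency: each named statement IS its registered stub -/

theorem xorDecomposition_holds : XorDecomposition := stub_xorDecomposition
theorem cosetCriterion_holds : CosetCriterion := stub_cosetCriterion
theorem loopUrsellIdentity_holds : LoopUrsellIdentity :=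
  stub_loopUrsellIdentity stub_xorDecomposition stub_cosetCriterion
theorem xorSlackIdentities_holds : XorSlackIdentities := stub_xorSlack stub_xorDecomposition stub_cosetCriterion
theorem perUComparison_holds : PerUComparison := stub_perUComparison
theorem loopUrsellDictionary_holds : LoopUrsellDictionary := stub_loopUrsellDictionary

/-! ### Name-keyed aliases of the stub statements (the hypotheses of the composition) -/
namespace Registered

/-- Alias of `XorDecomposition` keyed by the registered stub name. -/
abbrev stub_xorDecomposition : Prop := XorDecomposition
/-- Alias of `CosetCriterion` keyed by the registered stub name. -/
abbrev stub_cosetCriterion : Prop := CosetCriterion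
/-- Alias of `XorDecomposition → CosetCriterion → LoopUrsellIdentity` keyed by the registered stub name. -/
abbrev stub_loopUrsellIdentity : Prop := XorDecomposition → CosetCriterion → LoopUrsellIdentity
/-- Alias of `XorDecomposition → CosetCriterion → XorSlackIdentities` keyed by the registered stub name. -/
abbrev stub_xorSlack : Prop := XorDecomposition → CosetCriterion → XorSlackIdentities
/-- Alias of `PerUComparison` keyed by the registered stub name. -/
abbrev stub_perUComparison : Prop := PerUComparison
/-- Alias of `LoopUrsellDictionary` keyed by the registered stub name. -/
abbrev stub_loopUrsellDictionary : Prop := LoopUrsellDictionary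

end Registered

/-! ### The composition (REAL proofs, no `sorry`): stubs ⟹ `StrandsJoinBound` ⟹ the crux BY NAME -/

/-- `0 ≤ tanh β` for `β ≥ 0`. -/
theorem tanh_nonneg_of_nonneg {β : ℝ} (hβ : 0 ≤ β) : 0 ≤ Real.tanh β := by
  rw [Real.tanh_eq_sinh_div_cosh]
  exact div_nonneg (Real.sinh_nonneg_iff.2 hβ) (Real.cosh_pos β).le

/-- **The TRANSFER, proved**: XD, CC, LU, XS, PU, HD ⟹ the route support `StrandsJoinBound` (item 14647)
on every finite graph. Algebra: `U₄·Z⁰² = Z^QZ⁰ − ΣZZ` (HD) `= −2(A + B)` (LU);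
`J∪ = A + Σ_U w(U) L(U)` and `B = Σ_U w(U) R(U)` (XS) with `w(U) = t^{|U|} #𝓔_∅(U) ≥ 0` (`t = tanh β ≥ 0`)
and `L(U) ≤ R(U)` (PU at `s = t² ≤ 1`, `x = a₀ ≁_U y = a₂` from `¬E(U)`), so `J∪ ≤ A + B` and
`U₄·Z⁰² ≤ −2·J∪`. -/
theorem strandsJoinBound_of_xor (hXD : XorDecomposition) (hCC : CosetCriterion)
    (hLU : XorDecomposition → CosetCriterion → LoopUrsellIdentity)
    (hXS : XorDecomposition → CosetCriterion → XorSlackIdentities)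
    (hPU : PerUComparison) (hHD : LoopUrsellDictionary) : StrandsJoinBound := by
  intro V _ _ G _ β hβ a ha
  have ht0 : 0 ≤ Real.tanh β := tanh_nonneg_of_nonneg hβ
  have ht1 : Real.tanh β ≤ 1 := (Real.tanh_lt_one β).le
  have hs0 : 0 ≤ Real.tanh β ^ 2 := by positivity
  have hs1 : Real.tanh β ^ 2 ≤ 1 := pow_le_one₀ ht0 ht1
  have hid := hLU hXD hCC V G (Real.tanh β) a ha
  obtain ⟨hJA, hB⟩ := hXS hXD hCC V G (Real.tanh β) a ha
  have hdict := hHD V G β hβ a ha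
  -- `J∪ − A ≤ B`, pattern by pattern
  have hle : jointSumUnion G (Real.tanh β) a - xorSumA G (Real.tanh β) a ≤ xorSumB G (Real.tanh β) a := by
    rw [hJA, hB]
    refine Finset.sum_le_sum fun U hU => ?_
    have hUQ : U ∈ tJoins G Set.univ {a 0, a 1, a 2, a 3} := (Finset.mem_filter.1 hU).1
    have hUE : U ⊆ G.edgeFinset := ((mem_tJoins G).1 hUQ).1
    have hnotE : ¬ XorEvent a U := (Finset.mem_filter.1 hU).2
    have hsep : ¬ Conn U (a 0) (a 2) := fun h => hnotE (Or.inl h)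
    have hw : 0 ≤ Real.tanh β ^ #U * (#(evenSubgraphs G (↑U : Set (Sym2 V))) : ℝ) := by positivity
    exact mul_le_mul_of_nonneg_left
      (hPU V G (Real.tanh β ^ 2) hs0 hs1 U hUE (a 0) (a 2) hsep) hw
  have key : connectedFour (isingMeasure G Finset.univ β 0 .free) spinAt a *
      (loopO1PartitionFunction G (Real.tanh β) ∅) ^ 2 ≤ -(2 * jointSumUnion G (Real.tanh β) a) := by
    rw [hdict]
    linarith
  exact key

/-- **The crux from the stubs, BY NAME** (real proof): `StrandsJoinBound` from the six stubs
(`strandsJoinBound_of_xor`), then the route's own support `LatticeBoundFromStrands` (item 14648, by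
name — the shared half of every line on this crux; proved as `latticeBoundFromStrands_proof` in
`Theorems/FKParityRobustnessLatticeBoundFromStrands.lean`, 06:06Z) gives the tetrahedral lattice bound for every
`l ≥ 1`, and the LANDED `farMergingGivesU4_proof` (item 4471; shape = the route's tetrahedron, injective
by `decide`, scales `max L₀ 1`) gives `HasNontrivialU4 S` for every non-degenerate pointwise limit.
`hρ` is merely passed on (Disproof §A `iff_withoutPositivity`: cosmetic). -/
theorem JoinForcesU4_of (h₁ : Registered.stub_xorDecomposition) (h₂ : Registered.stub_cosetCriterion)
    (h₃ : Registered.stub_loopUrsellIdentity) (h₄ : Registered.stub_xorSlack)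
    (h₅ : Registered.stub_perUComparison) (h₆ : Registered.stub_loopUrsellDictionary)
    (h₇ : LatticeBoundFromStrands) :
    Summit.CriticalPhenomena.Ising3DConformalLimit.Theses.FKParityRobustness.JoinForcesU4 := by
  have hSJB : StrandsJoinBound := strandsJoinBound_of_xor h₁ h₂ h₃ h₄ h₅ h₆
  intro hK ρ S hρ hlim hnd
  obtain ⟨c, hc, hl⟩ := h₇ hK hSJB
  refine farMergingGivesU4_proof
    ⟨c, hc, _, ?_, fun L₀ => ⟨max L₀ 1, le_max_left _ _, hl _ (le_max_right _ _)⟩⟩ ρ S hρ hlim hnd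
  decide

/-- Wiring check: the registered stubs (and the route support by name) feed `JoinForcesU4_of` as stated. -/
example (h₇ : LatticeBoundFromStrands) :
    Summit.CriticalPhenomena.Ising3DConformalLimit.Theses.FKParityRobustness.JoinForcesU4 :=
  JoinForcesU4_of stub_xorDecomposition stub_cosetCriterion stub_loopUrsellIdentity stub_xorSlack
    stub_perUComparison stub_loopUrsellDictionary h₇

/-- Read-back: the support derived by the line is the route decl `StrandsJoinBound` itself. -/
example : StrandsJoinBound :=
  strandsJoinBound_of_xor stub_xorDecomposition stub_cosetCriterion stub_loopUrsellIdentity stub_xorSlack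
    stub_perUComparison stub_loopUrsellDictionary

end Summit.CriticalPhenomena.Ising3DConformalLimit.Cruxes.JoinForcesU4.XorCoordinates

end
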